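import Mathlib
import Literature.Combinatorics.AssociationSchemes.Basic

/-!
# MatrixMultiplication / CommutativeSchemes — crux `CommutativeRealization`, line `conjugacy`,
stub `stub_conjugacyScheme`: the group association scheme is a commutative association scheme

Route `CommutativeSchemes`, crux `CommutativeRealization` (stmt-MatrixMultiplication-9462, Cohn–Umans 2013
Conjecture 21 in ε-form), alternative line `Lines/conjugacy.lean` (group association schemes, CU13 §6.3).
This file proves the registered stub `stub_conjugacyScheme`: for every finite group `G`, the class map
`(x, y) ↦ [x⁻¹ y]` (the conjugacy class of `x⁻¹ y`), renumbered into `Fin k(G)` through an injective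
numbering `e` of the conjugacy classes (`k(G) = Nat.card (ConjClasses G)`), is the class map of a
COMMUTATIVE association scheme on the point set `G` in the sense of
`Literature.Combinatorics.AssociationSchemes.AssociationScheme` — the Schurian scheme of `G × G` acting on
`G` by `(u, v) · g = u g v⁻¹` (Cohn–Umans 2013 §4.2/§6.3: "This gives rise to a commutative coherent
configuration (regardless of whether G is commutative or not)"; Bannai–Ito, *Algebraic Combinatorics I*,
§II.7, Example "group scheme").

Proof. Write `f g = e [g]`, a class function (`f (c g c⁻¹) = f g`), and `cls x y = f (x⁻¹ y)`.
* one diagonal class: `[x⁻¹ y] = [z⁻¹ z] = [1] ↔ x⁻¹ y = 1 ↔ x = y`;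
* transpose: `[y⁻¹ x] = [(x⁻¹ y)⁻¹]`, and inversion is well defined on conjugacy classes, so
  `cls y x = τ (cls x y)` with `τ s = f (rep s)⁻¹` for any choice of representatives `rep`;
* coherence (`card_filter_conj_eq_of_conj_eq`): if `c (x'⁻¹ y') c⁻¹ = x⁻¹ y` then the two-sided translate
  `z ↦ (x c x'⁻¹) z c⁻¹` maps `x' ↦ x`, `y' ↦ y` and preserves `cls`, hence carries
  `{z | cls x' z = a ∧ cls z y' = b}` onto `{z | cls x z = a ∧ cls z y = b}`: the intersection count only
  depends on the class of `(x, y)`;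
* commutativity (`card_filter_conj_comm`): `z ↦ x z⁻¹ y` (inverse `z ↦ y z⁻¹ x`) carries
  `{z | cls x z = a ∧ cls z y = b}` onto `{z | cls x z = b ∧ cls z y = a}`, because
  `x⁻¹ (x z⁻¹ y) = z⁻¹ y` and `(x z⁻¹ y)⁻¹ y = (y⁻¹ x) (x⁻¹ z) (y⁻¹ x)⁻¹`.

References: H. Cohn, C. Umans, *Fast matrix multiplication using coherent configurations*, SODA 2013,
arXiv:1207.6528, §4.2 and §6.3; E. Bannai, T. Ito, *Algebraic Combinatorics I: Association Schemes*,
Benjamin/Cummings 1984, §II.7.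
-/

-- the tree's namespace `Summit.MatrixMultiplication.MatrixMultiplication.…` repeats a component by design
set_option linter.dupNamespace false

namespace Summit.MatrixMultiplication.MatrixMultiplication.Theorems

open Finset Function Literature.Combinatorics.AssociationSchemes

/-- **Coherence of the group association scheme** (Cohn–Umans 2013 §4.2/§6.3): for a class function
`f` on a finite group `G` (`f (c g c⁻¹) = f g`), if `x⁻¹ y` and `x'⁻¹ y'` are conjugate — say
`c (x'⁻¹ y') c⁻¹ = x⁻¹ y` — then the two-sided translate `z ↦ (x c x'⁻¹) z c⁻¹` maps `x' ↦ x`, `y' ↦ y`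
and preserves the class map `(u, v) ↦ f (u⁻¹ v)`, so the intersection counts
`#{z | f (x⁻¹ z) = a ∧ f (z⁻¹ y) = b}` at `(x, y)` and at `(x', y')` agree (the group `G × G` acts
transitively on the pairs of each class). [cite: CohnUmans2013, §6.3] -/
theorem card_filter_conj_eq_of_conj_eq {G : Type*} [Group G] [Fintype G] {ι : Type*} [DecidableEq ι]
    (f : G → ι) (hf : ∀ g c : G, f (c * g * c⁻¹) = f g) (a b : ι) {x y x' y' c : G}
    (h : c * (x'⁻¹ * y') * c⁻¹ = x⁻¹ * y) :
    (univ.filter fun z : G => f (x⁻¹ * z) = a ∧ f (z⁻¹ * y) = b).card =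
      (univ.filter fun z : G => f (x'⁻¹ * z) = a ∧ f (z⁻¹ * y') = b).card := by
  have hy : y = x * (c * (x'⁻¹ * y') * c⁻¹) := by rw [h, mul_inv_cancel_left]
  subst hy
  symm
  refine Finset.card_equiv
    (Equiv.mk (fun z : G => x * c * x'⁻¹ * z * c⁻¹) (fun z : G => x' * c⁻¹ * x⁻¹ * z * c) ?_ ?_) ?_
  · intro z
    show x' * c⁻¹ * x⁻¹ * (x * c * x'⁻¹ * z * c⁻¹) * c = z
    group
  · intro z
    show x * c * x'⁻¹ * (x' * c⁻¹ * x⁻¹ * z * c) * c⁻¹ = z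
    group
  · intro z
    simp only [mem_filter, mem_univ, true_and, Equiv.coe_fn_mk]
    rw [show x⁻¹ * (x * c * x'⁻¹ * z * c⁻¹) = c * (x'⁻¹ * z) * c⁻¹ by group, hf,
      show (x * c * x'⁻¹ * z * c⁻¹)⁻¹ * (x * (c * (x'⁻¹ * y') * c⁻¹)) = c * (z⁻¹ * y') * c⁻¹ by group,
      hf]

/-- **Commutativity of the group association scheme** (Cohn–Umans 2013 §6.3: the conjugacy-class
scheme is commutative "regardless of whether G is commutative or not"): for a class function `f` on a
finite group `G`, the bijection `z ↦ x z⁻¹ y` of `G` (inverse `z ↦ y z⁻¹ x`) carries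
`{z | f (x⁻¹ z) = a ∧ f (z⁻¹ y) = b}` onto `{z | f (x⁻¹ z) = b ∧ f (z⁻¹ y) = a}`, since
`x⁻¹ (x z⁻¹ y) = z⁻¹ y` and `(x z⁻¹ y)⁻¹ y = (y⁻¹ x) (x⁻¹ z) (y⁻¹ x)⁻¹`. [cite: CohnUmans2013, §6.3] -/
theorem card_filter_conj_comm {G : Type*} [Group G] [Fintype G] {ι : Type*} [DecidableEq ι]
    (f : G → ι) (hf : ∀ g c : G, f (c * g * c⁻¹) = f g) (a b : ι) (x y : G) :
    (univ.filter fun z : G => f (x⁻¹ * z) = a ∧ f (z⁻¹ * y) = b).card =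
      (univ.filter fun z : G => f (x⁻¹ * z) = b ∧ f (z⁻¹ * y) = a).card := by
  refine Finset.card_equiv
    (Equiv.mk (fun z : G => x * z⁻¹ * y) (fun z : G => y * z⁻¹ * x) ?_ ?_) ?_
  · intro z
    show y * (x * z⁻¹ * y)⁻¹ * x = z
    group
  · intro z
    show x * (y * z⁻¹ * x)⁻¹ * y = z
    group
  · intro z
    simp only [mem_filter, mem_univ, true_and, Equiv.coe_fn_mk]
    rw [show x⁻¹ * (x * z⁻¹ * y) = z⁻¹ * y by group,
      show (x * z⁻¹ * y)⁻¹ * y = (y⁻¹ * x) * (x⁻¹ * z) * (y⁻¹ * x)⁻¹ by group, hf]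
    exact and_comm

/-- **Stub `stub_conjugacyScheme` — the group association scheme is a commutative association scheme**
(Cohn–Umans 2013 §4.2, §6.3; Bannai–Ito §II.7, Example "group scheme"). For every finite group `G` there
is a commutative `AssociationScheme` on the point set `G`, with classes labelled by `Fin k(G)` through an
injective numbering `e` of the conjugacy classes (`e = Finite.equivFin (ConjClasses G)`), whose class map
is `cls x y = e [x⁻¹ y]`: the diagonal is the class of `1` and only it; the transpose of a class is the
inverse class; the intersection numbers only depend on the class of `(x, y)`
(`card_filter_conj_eq_of_conj_eq`); commutativity is `card_filter_conj_comm`.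
[cite: CohnUmans2013, §6.3] -/
theorem stub_conjugacyScheme :
    ∀ (G : Type) [Group G] [Fintype G],
      ∃ (e : ConjClasses G → Fin (Nat.card (ConjClasses G)))
        (S : AssociationScheme G (Fin (Nat.card (ConjClasses G)))),
        Function.Injective e ∧ S.IsCommutative ∧
          ∀ x y : G, S.cls x y = e (ConjClasses.mk (x⁻¹ * y)) := by
  intro G _ _
  -- a numbering of the conjugacy classes and a choice of representatives
  obtain ⟨e⟩ : Nonempty (ConjClasses G ≃ Fin (Nat.card (ConjClasses G))) := ⟨Finite.equivFin _⟩
  obtain ⟨rep, hrep⟩ : ∃ rep : ConjClasses G → G, ∀ q, ConjClasses.mk (rep q) = q :=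
    ⟨fun q => (ConjClasses.exists_rep q).choose, fun q => (ConjClasses.exists_rep q).choose_spec⟩
  -- `g ↦ e [g]` is a class function
  have hf : ∀ g c : G, e (ConjClasses.mk (c * g * c⁻¹)) = e (ConjClasses.mk g) := fun g c => by
    rw [e.apply_eq_iff_eq, ConjClasses.mk_eq_mk_iff_isConj]
    exact (isConj_iff.2 ⟨c, rfl⟩).symm
  refine ⟨e, ⟨fun x y => e (ConjClasses.mk (x⁻¹ * y)), fun x y z => ?_, ?_, ?_⟩, e.injective, ?_,
    fun x y => rfl⟩
  · -- (1') one diagonal class: `[x⁻¹ y] = [z⁻¹ z] = [1] ↔ x⁻¹ y = 1 ↔ x = y`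
    show e (ConjClasses.mk (x⁻¹ * y)) = e (ConjClasses.mk (z⁻¹ * z)) ↔ x = y
    rw [inv_mul_cancel, e.apply_eq_iff_eq, ConjClasses.mk_eq_mk_iff_isConj, isConj_one_left,
      inv_mul_eq_one]
  · -- (2) the transpose of a class is the inverse class
    refine ⟨fun s => e (ConjClasses.mk (rep (e.symm s))⁻¹), fun x y => ?_⟩
    show e (ConjClasses.mk (y⁻¹ * x)) =
      e (ConjClasses.mk (rep (e.symm (e (ConjClasses.mk (x⁻¹ * y)))))⁻¹)
    rw [e.symm_apply_apply, e.apply_eq_iff_eq, ConjClasses.mk_eq_mk_iff_isConj]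
    obtain ⟨c, hc⟩ :=
      isConj_iff.1 (ConjClasses.mk_eq_mk_iff_isConj.1 (hrep (ConjClasses.mk (x⁻¹ * y))))
    generalize rep (ConjClasses.mk (x⁻¹ * y)) = r at hc ⊢
    -- `hc : c * r * c⁻¹ = x⁻¹ * y`; conjugating by `c⁻¹` takes `y⁻¹ x = (x⁻¹ y)⁻¹` to `r⁻¹`
    rw [show y⁻¹ * x = (x⁻¹ * y)⁻¹ by rw [mul_inv_rev, inv_inv], ← hc]
    exact isConj_iff.2 ⟨c⁻¹, by group⟩
  · -- (3) coherence: the count at `(x, y)` equals the count at a chosen pair of the same class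
    classical
    refine ⟨fun a b s => if h : ∃ q : G × G, e (ConjClasses.mk (q.1⁻¹ * q.2)) = s then
        (univ.filter fun z => e (ConjClasses.mk (h.choose.1⁻¹ * z)) = a ∧
          e (ConjClasses.mk (z⁻¹ * h.choose.2)) = b).card else 0, fun a b x y => ?_⟩
    have hex : ∃ q : G × G, e (ConjClasses.mk (q.1⁻¹ * q.2)) = e (ConjClasses.mk (x⁻¹ * y)) :=
      ⟨(x, y), rfl⟩
    dsimp only
    rw [dif_pos hex]
    have hq := hex.choose_spec
    generalize hex.choose = q at hq ⊢
    obtain ⟨x', y'⟩ := q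
    obtain ⟨c, hc⟩ := isConj_iff.1 (ConjClasses.mk_eq_mk_iff_isConj.1 (e.injective hq))
    exact card_filter_conj_eq_of_conj_eq (fun g => e (ConjClasses.mk g)) hf a b hc
  · -- commutativity
    intro a b x y
    show (univ.filter fun z => e (ConjClasses.mk (x⁻¹ * z)) = a ∧
        e (ConjClasses.mk (z⁻¹ * y)) = b).card =
      (univ.filter fun z => e (ConjClasses.mk (x⁻¹ * z)) = b ∧
        e (ConjClasses.mk (z⁻¹ * y)) = a).card
    exact card_filter_conj_comm (fun g => e (ConjClasses.mk g)) hf a b x y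

end Summit.MatrixMultiplication.MatrixMultiplication.Theorems
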